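import Summits.ValiantsHypothesis.ValiantsHypothesis.Theorems.KPlusLogSqLawTropicalBMarkedEdgeExchange

/-!
# Route «KPlusLogSqLaw», crux `TropicalB` (stmt-ValiantsHypothesis-19771) — MARKED-EDGE sector:
# FOUR-FACTOR EXCHANGE (Abel summation for four unique maximisers)

HONEST FRAMING.  Helper file (cell `pub-symmetroid`, seat val-sym-trop-p4 (g17), 2026-08-28; `--supports
stmt-ValiantsHypothesis-19771 --as helper`).  It extends part 3 of the lineage's kernel FOUR-BIT LAW chain
(`…TropicalBMarkedEdgeExchange`: `abel_two`, `abel_three`, `factors_eq`) from three to FOUR unique maximisers.  This is the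
«Karamata half» of every 4-pattern law of the marked-edge sector whose certificate is a re-factorisation of the arc multiset of
four dominant covers — in particular of the located LAYER-2 CORE `{1,2},{1,3},{2,3},{0,4}` of five marked bits (this seat's memo
LAYER2-CORE-g17.md; the combinatorial half — existence of a majorising re-factorisation — is NOT proved here and is recorded there as
a conjecture).  Nothing here concerns `TropicalB` in its window, `WeakLifting`, the doors, `MatrixDescartes`
(stmt-ValiantsHypothesis-18050) or VP ≠ VNP.

ABSTRACT COVER SETTING (as in part 3, inline, no definition).  `V` finite; a COVER is `σ : Equiv.Perm V`; arcs carry a presence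
predicate `ok`, integer weights `w` and integer slopes `g`; the SCORE at `θ` is `∑ i, (w i (σ i) + θ * g i (σ i))`; a UNIQUE MAXIMISER at
`θ` is a present cover scoring strictly more than every other present cover.  A FACTORISATION of `σ₁ ⊎ σ₂ ⊎ σ₃ ⊎ σ₄` is recorded
pointwise: `List.Perm [F₁ i, F₂ i, F₃ i, F₄ i] [σ₁ i, σ₂ i, σ₃ i, σ₄ i]` for every node `i`.
CONTENTS: `abel_four` (arithmetic core), `sum_eq_of_factorisation₄`, `ok_of_factorisation₄`, and **`four_factors_eq`** — FOUR-FACTOR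
RIGIDITY: if `σ₁, …, σ₄` are unique maximisers at `θ₁ < θ₂ < θ₃ < θ₄` and `(F₁, …, F₄)` is a factorisation whose slope suffix sums
dominate (`x₄ ≤ y₄`, `x₃+x₄ ≤ y₃+y₄`, `x₂+x₃+x₄ ≤ y₂+y₃+y₄`, where `x_r`, `y_r` are the slopes of `σ_r`, `F_r`), then `F_r = σ_r` for
all `r`; equivalently a factorisation whose SORTED slope type majorises the maximisers' type and differs from it cannot exist
(Karamata's inequality in Abel-summation form, no concavity bookkeeping needed).
-/

set_option linter.dupNamespace false
set_option autoImplicit false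

namespace Summit.ValiantsHypothesis.ValiantsHypothesis.Theorems.KPlusLogSqLaw
namespace MarkedEdge
namespace FourBit

open Finset

/-! ### Arithmetic core (Abel summation, four terms) -/

/-- Four factors: if `B_r + θ_r y_r ≤ A_r + θ_r x_r` for `r = 1..4` with `θ₁ < θ₂ < θ₃ < θ₄`, equal totals `∑ B = ∑ A`,
`∑ y = ∑ x`, and the suffix domination `x₄ ≤ y₄`, `x₃ + x₄ ≤ y₃ + y₄`, `x₂ + x₃ + x₄ ≤ y₂ + y₃ + y₄`, then all four inequalities
are equalities. [folklore: Abel summation / Karamata] -/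
theorem abel_four {θ₁ θ₂ θ₃ θ₄ A₁ A₂ A₃ A₄ B₁ B₂ B₃ B₄ x₁ x₂ x₃ x₄ y₁ y₂ y₃ y₄ : ℤ}
    (h12 : θ₁ < θ₂) (h23 : θ₂ < θ₃) (h34 : θ₃ < θ₄)
    (hW : B₁ + B₂ + B₃ + B₄ = A₁ + A₂ + A₃ + A₄) (hG : y₁ + y₂ + y₃ + y₄ = x₁ + x₂ + x₃ + x₄)
    (hs₄ : x₄ ≤ y₄) (hs₃₄ : x₃ + x₄ ≤ y₃ + y₄) (hs₂₃₄ : x₂ + x₃ + x₄ ≤ y₂ + y₃ + y₄)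
    (h₁ : B₁ + θ₁ * y₁ ≤ A₁ + θ₁ * x₁) (h₂ : B₂ + θ₂ * y₂ ≤ A₂ + θ₂ * x₂)
    (h₃ : B₃ + θ₃ * y₃ ≤ A₃ + θ₃ * x₃) (h₄ : B₄ + θ₄ * y₄ ≤ A₄ + θ₄ * x₄) :
    B₁ + θ₁ * y₁ = A₁ + θ₁ * x₁ ∧ B₂ + θ₂ * y₂ = A₂ + θ₂ * x₂ ∧ B₃ + θ₃ * y₃ = A₃ + θ₃ * x₃ ∧
      B₄ + θ₄ * y₄ = A₄ + θ₄ * x₄ := by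
  have key₂ : 0 ≤ (θ₂ - θ₁) * (y₂ + y₃ + y₄ - x₂ - x₃ - x₄) := mul_nonneg (by linarith) (by linarith)
  have key₃ : 0 ≤ (θ₃ - θ₂) * (y₃ + y₄ - x₃ - x₄) := mul_nonneg (by linarith) (by linarith)
  have key₄ : 0 ≤ (θ₄ - θ₃) * (y₄ - x₄) := mul_nonneg (by linarith) (by linarith)
  have ek₂ : (θ₂ - θ₁) * (y₂ + y₃ + y₄ - x₂ - x₃ - x₄)
      = θ₂ * y₂ + θ₂ * y₃ + θ₂ * y₄ - θ₂ * x₂ - θ₂ * x₃ - θ₂ * x₄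
        - θ₁ * y₂ - θ₁ * y₃ - θ₁ * y₄ + θ₁ * x₂ + θ₁ * x₃ + θ₁ * x₄ := by ring
  have ek₃ : (θ₃ - θ₂) * (y₃ + y₄ - x₃ - x₄)
      = θ₃ * y₃ + θ₃ * y₄ - θ₃ * x₃ - θ₃ * x₄ - θ₂ * y₃ - θ₂ * y₄ + θ₂ * x₃ + θ₂ * x₄ := by ring
  have ek₄ : (θ₄ - θ₃) * (y₄ - x₄) = θ₄ * y₄ - θ₄ * x₄ - θ₃ * y₄ + θ₃ * x₄ := by ring
  have hy : y₁ = x₁ + x₂ + x₃ + x₄ - y₂ - y₃ - y₄ := by linarith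
  have e₁ : θ₁ * y₁ = θ₁ * x₁ + θ₁ * x₂ + θ₁ * x₃ + θ₁ * x₄ - θ₁ * y₂ - θ₁ * y₃ - θ₁ * y₄ := by
    rw [hy]; ring
  refine ⟨le_antisymm h₁ (by linarith), le_antisymm h₂ (by linarith), le_antisymm h₃ (by linarith),
    le_antisymm h₄ (by linarith)⟩

variable {V : Type*} [Fintype V] [DecidableEq V]

omit [DecidableEq V] in
/-- Weight (or slope) conservation along a four-fold factorisation. [folklore] -/
theorem sum_eq_of_factorisation₄ (f : V → V → ℤ) {σ₁ σ₂ σ₃ σ₄ F₁ F₂ F₃ F₄ : Equiv.Perm V}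
    (hP : ∀ i, List.Perm [F₁ i, F₂ i, F₃ i, F₄ i] [σ₁ i, σ₂ i, σ₃ i, σ₄ i]) :
    (∑ i, f i (F₁ i)) + (∑ i, f i (F₂ i)) + (∑ i, f i (F₃ i)) + ∑ i, f i (F₄ i)
      = (∑ i, f i (σ₁ i)) + (∑ i, f i (σ₂ i)) + (∑ i, f i (σ₃ i)) + ∑ i, f i (σ₄ i) := by
  rw [← Finset.sum_add_distrib, ← Finset.sum_add_distrib, ← Finset.sum_add_distrib, ← Finset.sum_add_distrib,
    ← Finset.sum_add_distrib, ← Finset.sum_add_distrib]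
  refine Finset.sum_congr rfl fun i _ => ?_
  have := ((hP i).map (f i)).sum_eq
  simp only [List.map_cons, List.map_nil, List.sum_cons, List.sum_nil, add_zero] at this
  linarith

omit [Fintype V] [DecidableEq V] in
/-- A factor of a factorisation of four present covers is present. [folklore] -/
theorem ok_of_factorisation₄ (ok : V → V → Prop) {σ₁ σ₂ σ₃ σ₄ F₁ F₂ F₃ F₄ : Equiv.Perm V}
    (hP : ∀ i, List.Perm [F₁ i, F₂ i, F₃ i, F₄ i] [σ₁ i, σ₂ i, σ₃ i, σ₄ i])
    (h₁ : ∀ i, ok i (σ₁ i)) (h₂ : ∀ i, ok i (σ₂ i)) (h₃ : ∀ i, ok i (σ₃ i)) (h₄ : ∀ i, ok i (σ₄ i)) :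
    (∀ i, ok i (F₁ i)) ∧ (∀ i, ok i (F₂ i)) ∧ (∀ i, ok i (F₃ i)) ∧ (∀ i, ok i (F₄ i)) := by
  have mem : ∀ i x, x ∈ [F₁ i, F₂ i, F₃ i, F₄ i] → ok i x := by
    intro i x hx
    have hx' := (hP i).mem_iff.mp hx
    simp only [List.mem_cons, List.not_mem_nil, or_false] at hx'
    rcases hx' with h | h | h | h <;> rw [h]
    exacts [h₁ i, h₂ i, h₃ i, h₄ i]
  exact ⟨fun i => mem i _ (by simp), fun i => mem i _ (by simp), fun i => mem i _ (by simp),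
    fun i => mem i _ (by simp)⟩

/-- **FOUR-FACTOR RIGIDITY (Karamata exchange for four unique maximisers).**  Let `σ₁, σ₂, σ₃, σ₄` be the unique maximisers
(among present covers) at `θ₁ < θ₂ < θ₃ < θ₄`, with slopes `x_r = ∑ i, g i (σ_r i)`, and let `(F₁, F₂, F₃, F₄)` be a
factorisation of the arc multiset `σ₁ ⊎ σ₂ ⊎ σ₃ ⊎ σ₄` (pointwise `List.Perm`) with slopes `y_r` whose suffix sums dominate:
`x₄ ≤ y₄`, `x₃ + x₄ ≤ y₃ + y₄`, `x₂ + x₃ + x₄ ≤ y₂ + y₃ + y₄`.  Then `F_r = σ_r` for every `r`.  Consequently a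
re-factorisation of four dominant covers whose (suitably ordered) slope type majorises theirs and differs from it does not exist —
the numerical half of every 4-pattern exchange law of the sector. [this seat's lemma; Abel summation `abel_four`, presence
`ok_of_factorisation₄`, conservation `sum_eq_of_factorisation₄`, uniqueness of the maximisers] -/
theorem four_factors_eq (ok : V → V → Prop) (w g : V → V → ℤ) {θ₁ θ₂ θ₃ θ₄ : ℤ}
    (h12 : θ₁ < θ₂) (h23 : θ₂ < θ₃) (h34 : θ₃ < θ₄) {σ₁ σ₂ σ₃ σ₄ : Equiv.Perm V}
    (h₁ : (∀ i, ok i (σ₁ i)) ∧ ∀ τ : Equiv.Perm V, τ ≠ σ₁ → (∀ i, ok i (τ i)) →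
      ∑ i, (w i (τ i) + θ₁ * g i (τ i)) < ∑ i, (w i (σ₁ i) + θ₁ * g i (σ₁ i)))
    (h₂ : (∀ i, ok i (σ₂ i)) ∧ ∀ τ : Equiv.Perm V, τ ≠ σ₂ → (∀ i, ok i (τ i)) →
      ∑ i, (w i (τ i) + θ₂ * g i (τ i)) < ∑ i, (w i (σ₂ i) + θ₂ * g i (σ₂ i)))
    (h₃ : (∀ i, ok i (σ₃ i)) ∧ ∀ τ : Equiv.Perm V, τ ≠ σ₃ → (∀ i, ok i (τ i)) →
      ∑ i, (w i (τ i) + θ₃ * g i (τ i)) < ∑ i, (w i (σ₃ i) + θ₃ * g i (σ₃ i)))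
    (h₄ : (∀ i, ok i (σ₄ i)) ∧ ∀ τ : Equiv.Perm V, τ ≠ σ₄ → (∀ i, ok i (τ i)) →
      ∑ i, (w i (τ i) + θ₄ * g i (τ i)) < ∑ i, (w i (σ₄ i) + θ₄ * g i (σ₄ i)))
    {F₁ F₂ F₃ F₄ : Equiv.Perm V} (hP : ∀ i, List.Perm [F₁ i, F₂ i, F₃ i, F₄ i] [σ₁ i, σ₂ i, σ₃ i, σ₄ i])
    (hs₄ : (∑ i, g i (σ₄ i)) ≤ ∑ i, g i (F₄ i))
    (hs₃₄ : (∑ i, g i (σ₃ i)) + (∑ i, g i (σ₄ i)) ≤ (∑ i, g i (F₃ i)) + ∑ i, g i (F₄ i))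
    (hs₂₃₄ : (∑ i, g i (σ₂ i)) + (∑ i, g i (σ₃ i)) + (∑ i, g i (σ₄ i))
      ≤ (∑ i, g i (F₂ i)) + (∑ i, g i (F₃ i)) + ∑ i, g i (F₄ i)) :
    F₁ = σ₁ ∧ F₂ = σ₂ ∧ F₃ = σ₃ ∧ F₄ = σ₄ := by
  obtain ⟨hok₁, hok₂, hok₃, hok₄⟩ := ok_of_factorisation₄ ok hP h₁.1 h₂.1 h₃.1 h₄.1
  have hW := sum_eq_of_factorisation₄ w hP
  have hG := sum_eq_of_factorisation₄ g hP
  obtain ⟨e₁, e₂, e₃, e₄⟩ := abel_four h12 h23 h34 hW hG hs₄ hs₃₄ hs₂₃₄ (score_le_of_isMax ok w g h₁ hok₁)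
    (score_le_of_isMax ok w g h₂ hok₂) (score_le_of_isMax ok w g h₃ hok₃) (score_le_of_isMax ok w g h₄ hok₄)
  refine ⟨?_, ?_, ?_, ?_⟩
  · by_contra hne; exact absurd e₁ (ne_of_lt (score_lt_of_isMax ok w g h₁ hok₁ hne))
  · by_contra hne; exact absurd e₂ (ne_of_lt (score_lt_of_isMax ok w g h₂ hok₂ hne))
  · by_contra hne; exact absurd e₃ (ne_of_lt (score_lt_of_isMax ok w g h₃ hok₃ hne))
  · by_contra hne; exact absurd e₄ (ne_of_lt (score_lt_of_isMax ok w g h₄ hok₄ hne))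


/-! ### Appendix (same seat, same day): NON-STRICT slope order and FIVE factors

A Karamata certificate may use one dominant cover several times (located example, m = 7: `B ⊎ E ⊎ E ⊎ Z = T₄ ⊎ T₈ ⊎ T₁₅ ⊎ T₂₀`);
listing the maximisers with repetition makes the parameter sequence only weakly increasing, so the rigidity lemmas are restated with
`θ₁ ≤ θ₂ ≤ ⋯` (same Abel summation), and a five-factor version is added (certificates with five terms occur at m = 6). -/

/-- `abel_four` with weakly increasing parameters. [folklore: Abel summation / Karamata] -/
theorem abel_four_le {θ₁ θ₂ θ₃ θ₄ A₁ A₂ A₃ A₄ B₁ B₂ B₃ B₄ x₁ x₂ x₃ x₄ y₁ y₂ y₃ y₄ : ℤ}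
    (h12 : θ₁ ≤ θ₂) (h23 : θ₂ ≤ θ₃) (h34 : θ₃ ≤ θ₄)
    (hW : B₁ + B₂ + B₃ + B₄ = A₁ + A₂ + A₃ + A₄) (hG : y₁ + y₂ + y₃ + y₄ = x₁ + x₂ + x₃ + x₄)
    (hs₄ : x₄ ≤ y₄) (hs₃₄ : x₃ + x₄ ≤ y₃ + y₄) (hs₂₃₄ : x₂ + x₃ + x₄ ≤ y₂ + y₃ + y₄)
    (h₁ : B₁ + θ₁ * y₁ ≤ A₁ + θ₁ * x₁) (h₂ : B₂ + θ₂ * y₂ ≤ A₂ + θ₂ * x₂)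
    (h₃ : B₃ + θ₃ * y₃ ≤ A₃ + θ₃ * x₃) (h₄ : B₄ + θ₄ * y₄ ≤ A₄ + θ₄ * x₄) :
    B₁ + θ₁ * y₁ = A₁ + θ₁ * x₁ ∧ B₂ + θ₂ * y₂ = A₂ + θ₂ * x₂ ∧ B₃ + θ₃ * y₃ = A₃ + θ₃ * x₃ ∧
      B₄ + θ₄ * y₄ = A₄ + θ₄ * x₄ := by
  have key₂ : 0 ≤ (θ₂ - θ₁) * (y₂ + y₃ + y₄ - x₂ - x₃ - x₄) := mul_nonneg (by linarith) (by linarith)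
  have key₃ : 0 ≤ (θ₃ - θ₂) * (y₃ + y₄ - x₃ - x₄) := mul_nonneg (by linarith) (by linarith)
  have key₄ : 0 ≤ (θ₄ - θ₃) * (y₄ - x₄) := mul_nonneg (by linarith) (by linarith)
  have ek₂ : (θ₂ - θ₁) * (y₂ + y₃ + y₄ - x₂ - x₃ - x₄)
      = θ₂ * y₂ + θ₂ * y₃ + θ₂ * y₄ - θ₂ * x₂ - θ₂ * x₃ - θ₂ * x₄
        - θ₁ * y₂ - θ₁ * y₃ - θ₁ * y₄ + θ₁ * x₂ + θ₁ * x₃ + θ₁ * x₄ := by ring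
  have ek₃ : (θ₃ - θ₂) * (y₃ + y₄ - x₃ - x₄)
      = θ₃ * y₃ + θ₃ * y₄ - θ₃ * x₃ - θ₃ * x₄ - θ₂ * y₃ - θ₂ * y₄ + θ₂ * x₃ + θ₂ * x₄ := by ring
  have ek₄ : (θ₄ - θ₃) * (y₄ - x₄) = θ₄ * y₄ - θ₄ * x₄ - θ₃ * y₄ + θ₃ * x₄ := by ring
  have hy : y₁ = x₁ + x₂ + x₃ + x₄ - y₂ - y₃ - y₄ := by linarith
  have e₁ : θ₁ * y₁ = θ₁ * x₁ + θ₁ * x₂ + θ₁ * x₃ + θ₁ * x₄ - θ₁ * y₂ - θ₁ * y₃ - θ₁ * y₄ := by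
    rw [hy]; ring
  refine ⟨le_antisymm h₁ (by linarith), le_antisymm h₂ (by linarith), le_antisymm h₃ (by linarith),
    le_antisymm h₄ (by linarith)⟩

/-- **FOUR-FACTOR RIGIDITY, weakly increasing parameters** (maximisers may repeat: `σ_r = σ_s` allowed when `θ_r = θ_s`).
Same statement and proof as `four_factors_eq` with `θ₁ ≤ θ₂ ≤ θ₃ ≤ θ₄`. [this seat's lemma] -/
theorem four_factors_eq_le (ok : V → V → Prop) (w g : V → V → ℤ) {θ₁ θ₂ θ₃ θ₄ : ℤ}
    (h12 : θ₁ ≤ θ₂) (h23 : θ₂ ≤ θ₃) (h34 : θ₃ ≤ θ₄) {σ₁ σ₂ σ₃ σ₄ : Equiv.Perm V}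
    (h₁ : (∀ i, ok i (σ₁ i)) ∧ ∀ τ : Equiv.Perm V, τ ≠ σ₁ → (∀ i, ok i (τ i)) →
      ∑ i, (w i (τ i) + θ₁ * g i (τ i)) < ∑ i, (w i (σ₁ i) + θ₁ * g i (σ₁ i)))
    (h₂ : (∀ i, ok i (σ₂ i)) ∧ ∀ τ : Equiv.Perm V, τ ≠ σ₂ → (∀ i, ok i (τ i)) →
      ∑ i, (w i (τ i) + θ₂ * g i (τ i)) < ∑ i, (w i (σ₂ i) + θ₂ * g i (σ₂ i)))
    (h₃ : (∀ i, ok i (σ₃ i)) ∧ ∀ τ : Equiv.Perm V, τ ≠ σ₃ → (∀ i, ok i (τ i)) →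
      ∑ i, (w i (τ i) + θ₃ * g i (τ i)) < ∑ i, (w i (σ₃ i) + θ₃ * g i (σ₃ i)))
    (h₄ : (∀ i, ok i (σ₄ i)) ∧ ∀ τ : Equiv.Perm V, τ ≠ σ₄ → (∀ i, ok i (τ i)) →
      ∑ i, (w i (τ i) + θ₄ * g i (τ i)) < ∑ i, (w i (σ₄ i) + θ₄ * g i (σ₄ i)))
    {F₁ F₂ F₃ F₄ : Equiv.Perm V} (hP : ∀ i, List.Perm [F₁ i, F₂ i, F₃ i, F₄ i] [σ₁ i, σ₂ i, σ₃ i, σ₄ i])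
    (hs₄ : (∑ i, g i (σ₄ i)) ≤ ∑ i, g i (F₄ i))
    (hs₃₄ : (∑ i, g i (σ₃ i)) + (∑ i, g i (σ₄ i)) ≤ (∑ i, g i (F₃ i)) + ∑ i, g i (F₄ i))
    (hs₂₃₄ : (∑ i, g i (σ₂ i)) + (∑ i, g i (σ₃ i)) + (∑ i, g i (σ₄ i))
      ≤ (∑ i, g i (F₂ i)) + (∑ i, g i (F₃ i)) + ∑ i, g i (F₄ i)) :
    F₁ = σ₁ ∧ F₂ = σ₂ ∧ F₃ = σ₃ ∧ F₄ = σ₄ := by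
  obtain ⟨hok₁, hok₂, hok₃, hok₄⟩ := ok_of_factorisation₄ ok hP h₁.1 h₂.1 h₃.1 h₄.1
  have hW := sum_eq_of_factorisation₄ w hP
  have hG := sum_eq_of_factorisation₄ g hP
  obtain ⟨e₁, e₂, e₃, e₄⟩ := abel_four_le h12 h23 h34 hW hG hs₄ hs₃₄ hs₂₃₄ (score_le_of_isMax ok w g h₁ hok₁)
    (score_le_of_isMax ok w g h₂ hok₂) (score_le_of_isMax ok w g h₃ hok₃) (score_le_of_isMax ok w g h₄ hok₄)
  refine ⟨?_, ?_, ?_, ?_⟩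
  · by_contra hne; exact absurd e₁ (ne_of_lt (score_lt_of_isMax ok w g h₁ hok₁ hne))
  · by_contra hne; exact absurd e₂ (ne_of_lt (score_lt_of_isMax ok w g h₂ hok₂ hne))
  · by_contra hne; exact absurd e₃ (ne_of_lt (score_lt_of_isMax ok w g h₃ hok₃ hne))
  · by_contra hne; exact absurd e₄ (ne_of_lt (score_lt_of_isMax ok w g h₄ hok₄ hne))

/-- Five factors, weakly increasing parameters: `B_r + θ_r y_r ≤ A_r + θ_r x_r` (`r = 1..5`), equal totals and suffix domination
of the slopes force five equalities. [folklore: Abel summation / Karamata] -/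
theorem abel_five_le {θ₁ θ₂ θ₃ θ₄ θ₅ A₁ A₂ A₃ A₄ A₅ B₁ B₂ B₃ B₄ B₅ x₁ x₂ x₃ x₄ x₅ y₁ y₂ y₃ y₄ y₅ : ℤ}
    (h12 : θ₁ ≤ θ₂) (h23 : θ₂ ≤ θ₃) (h34 : θ₃ ≤ θ₄) (h45 : θ₄ ≤ θ₅)
    (hW : B₁ + B₂ + B₃ + B₄ + B₅ = A₁ + A₂ + A₃ + A₄ + A₅)
    (hG : y₁ + y₂ + y₃ + y₄ + y₅ = x₁ + x₂ + x₃ + x₄ + x₅)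
    (hs₅ : x₅ ≤ y₅) (hs₄₅ : x₄ + x₅ ≤ y₄ + y₅) (hs₃₄₅ : x₃ + x₄ + x₅ ≤ y₃ + y₄ + y₅)
    (hs₂₃₄₅ : x₂ + x₃ + x₄ + x₅ ≤ y₂ + y₃ + y₄ + y₅)
    (h₁ : B₁ + θ₁ * y₁ ≤ A₁ + θ₁ * x₁) (h₂ : B₂ + θ₂ * y₂ ≤ A₂ + θ₂ * x₂) (h₃ : B₃ + θ₃ * y₃ ≤ A₃ + θ₃ * x₃)
    (h₄ : B₄ + θ₄ * y₄ ≤ A₄ + θ₄ * x₄) (h₅ : B₅ + θ₅ * y₅ ≤ A₅ + θ₅ * x₅) :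
    B₁ + θ₁ * y₁ = A₁ + θ₁ * x₁ ∧ B₂ + θ₂ * y₂ = A₂ + θ₂ * x₂ ∧ B₃ + θ₃ * y₃ = A₃ + θ₃ * x₃ ∧
      B₄ + θ₄ * y₄ = A₄ + θ₄ * x₄ ∧ B₅ + θ₅ * y₅ = A₅ + θ₅ * x₅ := by
  have key₂ : 0 ≤ (θ₂ - θ₁) * (y₂ + y₃ + y₄ + y₅ - x₂ - x₃ - x₄ - x₅) := mul_nonneg (by linarith) (by linarith)
  have key₃ : 0 ≤ (θ₃ - θ₂) * (y₃ + y₄ + y₅ - x₃ - x₄ - x₅) := mul_nonneg (by linarith) (by linarith)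
  have key₄ : 0 ≤ (θ₄ - θ₃) * (y₄ + y₅ - x₄ - x₅) := mul_nonneg (by linarith) (by linarith)
  have key₅ : 0 ≤ (θ₅ - θ₄) * (y₅ - x₅) := mul_nonneg (by linarith) (by linarith)
  have ek₂ : (θ₂ - θ₁) * (y₂ + y₃ + y₄ + y₅ - x₂ - x₃ - x₄ - x₅)
      = θ₂ * y₂ + θ₂ * y₃ + θ₂ * y₄ + θ₂ * y₅ - θ₂ * x₂ - θ₂ * x₃ - θ₂ * x₄ - θ₂ * x₅
        - θ₁ * y₂ - θ₁ * y₃ - θ₁ * y₄ - θ₁ * y₅ + θ₁ * x₂ + θ₁ * x₃ + θ₁ * x₄ + θ₁ * x₅ := by ring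
  have ek₃ : (θ₃ - θ₂) * (y₃ + y₄ + y₅ - x₃ - x₄ - x₅)
      = θ₃ * y₃ + θ₃ * y₄ + θ₃ * y₅ - θ₃ * x₃ - θ₃ * x₄ - θ₃ * x₅
        - θ₂ * y₃ - θ₂ * y₄ - θ₂ * y₅ + θ₂ * x₃ + θ₂ * x₄ + θ₂ * x₅ := by ring
  have ek₄ : (θ₄ - θ₃) * (y₄ + y₅ - x₄ - x₅)
      = θ₄ * y₄ + θ₄ * y₅ - θ₄ * x₄ - θ₄ * x₅ - θ₃ * y₄ - θ₃ * y₅ + θ₃ * x₄ + θ₃ * x₅ := by ring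
  have ek₅ : (θ₅ - θ₄) * (y₅ - x₅) = θ₅ * y₅ - θ₅ * x₅ - θ₄ * y₅ + θ₄ * x₅ := by ring
  have hy : y₁ = x₁ + x₂ + x₃ + x₄ + x₅ - y₂ - y₃ - y₄ - y₅ := by linarith
  have e₁ : θ₁ * y₁ = θ₁ * x₁ + θ₁ * x₂ + θ₁ * x₃ + θ₁ * x₄ + θ₁ * x₅
      - θ₁ * y₂ - θ₁ * y₃ - θ₁ * y₄ - θ₁ * y₅ := by rw [hy]; ring
  refine ⟨le_antisymm h₁ (by linarith), le_antisymm h₂ (by linarith), le_antisymm h₃ (by linarith),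
    le_antisymm h₄ (by linarith), le_antisymm h₅ (by linarith)⟩

omit [DecidableEq V] in
/-- Weight (or slope) conservation along a five-fold factorisation. [folklore] -/
theorem sum_eq_of_factorisation₅ (f : V → V → ℤ) {σ₁ σ₂ σ₃ σ₄ σ₅ F₁ F₂ F₃ F₄ F₅ : Equiv.Perm V}
    (hP : ∀ i, List.Perm [F₁ i, F₂ i, F₃ i, F₄ i, F₅ i] [σ₁ i, σ₂ i, σ₃ i, σ₄ i, σ₅ i]) :
    (∑ i, f i (F₁ i)) + (∑ i, f i (F₂ i)) + (∑ i, f i (F₃ i)) + (∑ i, f i (F₄ i)) + ∑ i, f i (F₅ i)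
      = (∑ i, f i (σ₁ i)) + (∑ i, f i (σ₂ i)) + (∑ i, f i (σ₃ i)) + (∑ i, f i (σ₄ i)) + ∑ i, f i (σ₅ i) := by
  rw [← Finset.sum_add_distrib, ← Finset.sum_add_distrib, ← Finset.sum_add_distrib, ← Finset.sum_add_distrib,
    ← Finset.sum_add_distrib, ← Finset.sum_add_distrib, ← Finset.sum_add_distrib, ← Finset.sum_add_distrib]
  refine Finset.sum_congr rfl fun i _ => ?_
  have := ((hP i).map (f i)).sum_eq
  simp only [List.map_cons, List.map_nil, List.sum_cons, List.sum_nil, add_zero] at this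
  linarith

omit [Fintype V] [DecidableEq V] in
/-- A factor of a factorisation of five present covers is present. [folklore] -/
theorem ok_of_factorisation₅ (ok : V → V → Prop) {σ₁ σ₂ σ₃ σ₄ σ₅ F₁ F₂ F₃ F₄ F₅ : Equiv.Perm V}
    (hP : ∀ i, List.Perm [F₁ i, F₂ i, F₃ i, F₄ i, F₅ i] [σ₁ i, σ₂ i, σ₃ i, σ₄ i, σ₅ i])
    (h₁ : ∀ i, ok i (σ₁ i)) (h₂ : ∀ i, ok i (σ₂ i)) (h₃ : ∀ i, ok i (σ₃ i)) (h₄ : ∀ i, ok i (σ₄ i))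
    (h₅ : ∀ i, ok i (σ₅ i)) :
    (∀ i, ok i (F₁ i)) ∧ (∀ i, ok i (F₂ i)) ∧ (∀ i, ok i (F₃ i)) ∧ (∀ i, ok i (F₄ i)) ∧ (∀ i, ok i (F₅ i)) := by
  have mem : ∀ i x, x ∈ [F₁ i, F₂ i, F₃ i, F₄ i, F₅ i] → ok i x := by
    intro i x hx
    have hx' := (hP i).mem_iff.mp hx
    simp only [List.mem_cons, List.not_mem_nil, or_false] at hx'
    rcases hx' with h | h | h | h | h <;> rw [h]
    exacts [h₁ i, h₂ i, h₃ i, h₄ i, h₅ i]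
  exact ⟨fun i => mem i _ (by simp), fun i => mem i _ (by simp), fun i => mem i _ (by simp),
    fun i => mem i _ (by simp), fun i => mem i _ (by simp)⟩

/-- **FIVE-FACTOR RIGIDITY** (weakly increasing parameters): unique maximisers `σ₁, …, σ₅` at `θ₁ ≤ ⋯ ≤ θ₅` and a pointwise
factorisation `(F₁, …, F₅)` of `σ₁ ⊎ ⋯ ⊎ σ₅` whose slope suffix sums dominate ⇒ `F_r = σ_r` for all `r`. [this seat's lemma] -/
theorem five_factors_eq_le (ok : V → V → Prop) (w g : V → V → ℤ) {θ₁ θ₂ θ₃ θ₄ θ₅ : ℤ}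
    (h12 : θ₁ ≤ θ₂) (h23 : θ₂ ≤ θ₃) (h34 : θ₃ ≤ θ₄) (h45 : θ₄ ≤ θ₅) {σ₁ σ₂ σ₃ σ₄ σ₅ : Equiv.Perm V}
    (h₁ : (∀ i, ok i (σ₁ i)) ∧ ∀ τ : Equiv.Perm V, τ ≠ σ₁ → (∀ i, ok i (τ i)) →
      ∑ i, (w i (τ i) + θ₁ * g i (τ i)) < ∑ i, (w i (σ₁ i) + θ₁ * g i (σ₁ i)))
    (h₂ : (∀ i, ok i (σ₂ i)) ∧ ∀ τ : Equiv.Perm V, τ ≠ σ₂ → (∀ i, ok i (τ i)) →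
      ∑ i, (w i (τ i) + θ₂ * g i (τ i)) < ∑ i, (w i (σ₂ i) + θ₂ * g i (σ₂ i)))
    (h₃ : (∀ i, ok i (σ₃ i)) ∧ ∀ τ : Equiv.Perm V, τ ≠ σ₃ → (∀ i, ok i (τ i)) →
      ∑ i, (w i (τ i) + θ₃ * g i (τ i)) < ∑ i, (w i (σ₃ i) + θ₃ * g i (σ₃ i)))
    (h₄ : (∀ i, ok i (σ₄ i)) ∧ ∀ τ : Equiv.Perm V, τ ≠ σ₄ → (∀ i, ok i (τ i)) →
      ∑ i, (w i (τ i) + θ₄ * g i (τ i)) < ∑ i, (w i (σ₄ i) + θ₄ * g i (σ₄ i)))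
    (h₅ : (∀ i, ok i (σ₅ i)) ∧ ∀ τ : Equiv.Perm V, τ ≠ σ₅ → (∀ i, ok i (τ i)) →
      ∑ i, (w i (τ i) + θ₅ * g i (τ i)) < ∑ i, (w i (σ₅ i) + θ₅ * g i (σ₅ i)))
    {F₁ F₂ F₃ F₄ F₅ : Equiv.Perm V}
    (hP : ∀ i, List.Perm [F₁ i, F₂ i, F₃ i, F₄ i, F₅ i] [σ₁ i, σ₂ i, σ₃ i, σ₄ i, σ₅ i])
    (hs₅ : (∑ i, g i (σ₅ i)) ≤ ∑ i, g i (F₅ i))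
    (hs₄₅ : (∑ i, g i (σ₄ i)) + (∑ i, g i (σ₅ i)) ≤ (∑ i, g i (F₄ i)) + ∑ i, g i (F₅ i))
    (hs₃₄₅ : (∑ i, g i (σ₃ i)) + (∑ i, g i (σ₄ i)) + (∑ i, g i (σ₅ i))
      ≤ (∑ i, g i (F₃ i)) + (∑ i, g i (F₄ i)) + ∑ i, g i (F₅ i))
    (hs₂₃₄₅ : (∑ i, g i (σ₂ i)) + (∑ i, g i (σ₃ i)) + (∑ i, g i (σ₄ i)) + (∑ i, g i (σ₅ i))
      ≤ (∑ i, g i (F₂ i)) + (∑ i, g i (F₃ i)) + (∑ i, g i (F₄ i)) + ∑ i, g i (F₅ i)) :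
    F₁ = σ₁ ∧ F₂ = σ₂ ∧ F₃ = σ₃ ∧ F₄ = σ₄ ∧ F₅ = σ₅ := by
  obtain ⟨hok₁, hok₂, hok₃, hok₄, hok₅⟩ := ok_of_factorisation₅ ok hP h₁.1 h₂.1 h₃.1 h₄.1 h₅.1
  have hW := sum_eq_of_factorisation₅ w hP
  have hG := sum_eq_of_factorisation₅ g hP
  obtain ⟨e₁, e₂, e₃, e₄, e₅⟩ := abel_five_le h12 h23 h34 h45 hW hG hs₅ hs₄₅ hs₃₄₅ hs₂₃₄₅
    (score_le_of_isMax ok w g h₁ hok₁) (score_le_of_isMax ok w g h₂ hok₂) (score_le_of_isMax ok w g h₃ hok₃)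
    (score_le_of_isMax ok w g h₄ hok₄) (score_le_of_isMax ok w g h₅ hok₅)
  refine ⟨?_, ?_, ?_, ?_, ?_⟩
  · by_contra hne; exact absurd e₁ (ne_of_lt (score_lt_of_isMax ok w g h₁ hok₁ hne))
  · by_contra hne; exact absurd e₂ (ne_of_lt (score_lt_of_isMax ok w g h₂ hok₂ hne))
  · by_contra hne; exact absurd e₃ (ne_of_lt (score_lt_of_isMax ok w g h₃ hok₃ hne))
  · by_contra hne; exact absurd e₄ (ne_of_lt (score_lt_of_isMax ok w g h₄ hok₄ hne))
  · by_contra hne; exact absurd e₅ (ne_of_lt (score_lt_of_isMax ok w g h₅ hok₅ hne))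

end FourBit
end MarkedEdge
end Summit.ValiantsHypothesis.ValiantsHypothesis.Theorems.KPlusLogSqLaw
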